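import Summits.BirchSwinnertonDyer.BirchSwinnertonDyer.Theorems.BiquadraticEisensteinDescentEisensteinHeartFlatCMInertBadKPrimeCMFieldTheta
import Summits.BirchSwinnertonDyer.Rank1Residual.X12.CMInertTrace
import Literature.NumberTheory.EllipticCurves.ComplexMultiplicationDeuringGrossencharacter
import Literature.NumberTheory.EllipticCurves.IsogenyGroundFieldExtension
import Literature.NumberTheory.EllipticCurves.ShafarevichGoodReductionBadPlacesProofs
import Literature.NumberTheory.EllipticCurves.ComplexMultiplicationLFunctionIsogenyHoldsProofs
import Literature.NumberTheory.EllipticCurves.IsogenyHasCMIffJMemProofs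
import Literature.NumberTheory.EllipticCurves.ModularCurveManinSemistableBridgeProofs
import HarnessLib

set_option linter.dupNamespace false -- `Summit.BirchSwinnertonDyer.BirchSwinnertonDyer.Theorems.…` (summit = sub)
set_option autoImplicit false

/-!
# Crux `EisensteinHeartFlatCMInertBadKPrime` (stmt-BirchSwinnertonDyer-21341), line `hsieh-lambda`, layer 2 (V2):
# Deuring's Grössencharacter for ALL thirteen CM `j`-invariants (transport along the isogeny to the maximal order)

Route `BiquadraticEisensteinDescent` (cell `pub/bsd-wall`, width seat `bsd-wall-cm-bed-w4`). THEOREMS ONLY (no definition, no named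
fact, no `sorry`); supports stmt-BirchSwinnertonDyer-21341 as a helper; nothing about the crux's input or any case of BSD is asserted.

The route's Deuring input `Deuring_exists_heckeCharacter_of_maximalCM` (named fact, taken here as the HYPOTHESIS `hD`) speaks of curves
with `W.j ∈ maximalCMJInvariants` (nine `j`), whereas the crux quantifies over every CM curve (`W.HasCM`: thirteen `j`, four of them
— `54000, 287496, −12288000, 16581375` — with CM by a NON-maximal order). This file transports Deuring's clauses (i)–(v) to every CM
curve `W/ℚ`: `W` is `ℚ`-isogenous to a globally minimal `W₁` with `W₁.j ∈ maximalCMJInvariants` in the SAME CM field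
(`X12.exists_isGloballyMinimal_isIsogenous_maximal_cmFieldDiscr_eq`), Deuring's `ψ` for `W₁` is a Hecke character of that field, and
along the isogeny: good reduction of the base changes at every place of `K₁` agrees (`IsIsogenous.extendScalars` + *AEC* VII.7.2,
`hasGoodReductionAt_iff_of_isIsogenous`), good reduction and `a_ℓ` over `ℚ` agree (`hasGoodReductionAtPrime_iff`,
`frobeniusTrace_eq_of_isIsogenous`), and `L(W, s) = L(W₁, s)` (`IsIsogenous.LSeries_eq`, Faltings). Hence
`exists_deuringCharacter_of_hasCM`: clauses (i)–(v) hold VERBATIM for `W`, for every `K₁` with `[K₁:ℚ] = 2` and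
`θ² = cmFieldDiscrOfJ W.j` and every `c ≠ 1` — together with the maximal model `W₁` (`IsCMFieldOfJ K₁ W₁.j`, `W₁.HasCM`, the isogeny)
for the consumers that are stated at maximal `j` (e.g. `…BranchBadPrimes`, `…CMFieldTheta.exists_theta_datum`), and the newform
transport `isNewformOf_maximal_model`. Also `exists_theta_datum_of_hasCM`: the `K_CM`-element datum of `…CMFieldTheta` for all
thirteen `j`.

References: [SilvermanATAEC1994] Ch. II Thm. 9.2, Thm. 10.5, App. A §3; [SilvermanAEC2009] Cor. VII.7.2; [Faltings1983Endlichkeit] §5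
Kor. 2; [Knapp1993] Thm. 11.67.
-/

noncomputable section

open scoped NumberField
open NumberField IsDedekindDomain Ideal CongruenceSubgroup WeierstrassCurve
open Literature.NumberTheory.GaloisRepresentations Literature.NumberTheory.EllipticCurves
open Literature.NumberTheory.EllipticCurves.Rank1Residual Literature.NumberTheory.EllipticCurves.ModularForms
open Summit.BirchSwinnertonDyer.Rank1Residual.X12

namespace Summit.BirchSwinnertonDyer.BirchSwinnertonDyer.Theorems.BiquadraticEisensteinDescentEisensteinHeartFlatCMInertBadKPrimeDeuringTransport

variable {K₁ : Type} [Field K₁] [NumberField K₁]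

/-! ## §1 The maximal model in the same CM field -/

/-- **Maximal model.** A CM curve `W/ℚ` (any of the thirteen `j`) is `ℚ`-isogenous to a globally minimal `W₁` with
`W₁.j ∈ maximalCMJInvariants`, `W₁.HasCM`, and `cmFieldDiscr W₁.j = cmFieldDiscrOfJ W.j`; so any quadratic `K₁` containing a square root of
`cmFieldDiscrOfJ W.j` is `IsCMFieldOfJ K₁ W₁.j`. [cite: SilvermanATAEC1994, App. A §3] [cite: SilvermanAEC2009, Appendix C §11, Examples 11.3.1–11.3.2] -/
theorem exists_maximal_model (W : WeierstrassCurve ℚ) [W.IsElliptic] (hCM : W.HasCM) (h2 : Module.finrank ℚ K₁ = 2)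
    (hθ : ∃ θ : K₁, θ ^ 2 = (cmFieldDiscrOfJ W.j : K₁)) :
    ∃ (W₁ : WeierstrassCurve ℚ) (_ : W₁.IsElliptic) (_ : W₁.IsGloballyMinimal),
      IsIsogenous W W₁ ∧ W₁.j ∈ maximalCMJInvariants ∧ W₁.HasCM ∧ cmFieldDiscr W₁.j = cmFieldDiscrOfJ W.j ∧
        IsCMFieldOfJ K₁ W₁.j := by
  have hj : W.j ∈ cmJInvariants := (hasCM_iff_j_mem_holds W).mp hCM
  obtain ⟨W₁, hE₁, hmin₁, hiso, hj₁, hd₁⟩ := exists_isGloballyMinimal_isIsogenous_maximal_cmFieldDiscr_eq W hj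
  haveI := hE₁
  refine ⟨W₁, hE₁, hmin₁, hiso, hj₁, (hasCM_iff_j_mem_holds W₁).mpr (maximalCMJInvariants_subset_cmJInvariants hj₁), hd₁,
    h2, ?_⟩
  obtain ⟨θ, hθ⟩ := hθ
  exact ⟨θ, by rw [hd₁]; exact hθ⟩

/-! ## §2 Transport of Deuring's clauses along a `ℚ`-isogeny -/

/-- **Clause (iii) along an isogeny**: for `ℚ`-isogenous `W ∼ W₁` and any number field `K₁`, the base changes are `K₁`-isogenous
(`IsIsogenous.extendScalars`), hence have good reduction at the same places (*AEC* VII.7.2); so «`ψ` unramified at `w` ↔ `W₁ ⊗ K₁`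
good at `w`» transports to `W`. [cite: SilvermanAEC2009, Cor. VII.7.2] -/
theorem hasGoodReductionAt_baseChange_iff_of_isIsogenous {W W₁ : WeierstrassCurve ℚ} [W.IsElliptic] [W₁.IsElliptic]
    (hiso : IsIsogenous W W₁) (w : HeightOneSpectrum (𝓞 K₁)) :
    (W.baseChange K₁).HasGoodReductionAt w ↔ (W₁.baseChange K₁).HasGoodReductionAt w := by
  haveI : (W.baseChange K₁).IsElliptic := inferInstanceAs (W.map (algebraMap ℚ K₁)).IsElliptic
  haveI : (W₁.baseChange K₁).IsElliptic := inferInstanceAs (W₁.map (algebraMap ℚ K₁)).IsElliptic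
  exact (hiso.extendScalars K₁).hasGoodReductionAt_iff_of_isIsogenous w

/-- **Clause (iii) transported**: `(∀ w, ψ unr. at w ↔ W₁ ⊗ K₁ good at w) → (∀ w, ψ unr. at w ↔ W ⊗ K₁ good at w)`.
[cite: SilvermanAEC2009, Cor. VII.7.2] -/
theorem deuring_iii_of_isIsogenous {W W₁ : WeierstrassCurve ℚ} [W.IsElliptic] [W₁.IsElliptic] (hiso : IsIsogenous W W₁)
    {ψ : HeckeCharacter K₁} (h : ∀ w : HeightOneSpectrum (𝓞 K₁), ψ.IsUnramifiedAt w ↔ (W₁.baseChange K₁).HasGoodReductionAt w) :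
    ∀ w : HeightOneSpectrum (𝓞 K₁), ψ.IsUnramifiedAt w ↔ (W.baseChange K₁).HasGoodReductionAt w :=
  fun w ↦ (h w).trans (hasGoodReductionAt_baseChange_iff_of_isIsogenous hiso w).symm

/-- **Clause (iv) transported**: the Euler-factor clause of Deuring's theorem for `W₁` gives the same clause for a `ℚ`-isogenous
globally minimal `W` (good reduction and `a_ℓ` are isogeny invariants: *AEC* VII.7.2, Faltings §5 Kor. 2).
[cite: SilvermanAEC2009, Cor. VII.7.2] [cite: Faltings1983Endlichkeit, §5 Korollar 2, (i) ⇒ (iv)] -/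
theorem deuring_iv_of_isIsogenous {W W₁ : WeierstrassCurve ℚ} [W.IsElliptic] [W.IsGloballyMinimal] [W₁.IsElliptic]
    [W₁.IsGloballyMinimal] (hiso : IsIsogenous W W₁) {c : K₁ ≃ₐ[ℚ] K₁} {ψ : HeckeCharacter K₁}
    (h : ∀ (p : ℕ) [Fact p.Prime], W₁.HasGoodReductionAtPrime p →
      ∀ w : HeightOneSpectrum (𝓞 K₁), (p : 𝓞 K₁) ∈ w.asIdeal →
        ψ.IsUnramifiedAt w ∧
        (c • w ≠ w →
          ψ.valueAtUniformizer w + ψ.valueAtUniformizer (c • w) = (W₁.frobeniusTrace p : ℂ) ∧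
          ψ.valueAtUniformizer w * ψ.valueAtUniformizer (c • w) = (p : ℂ)) ∧
        (c • w = w → W₁.frobeniusTrace p = 0 ∧ ψ.valueAtUniformizer w = -(p : ℂ))) :
    ∀ (p : ℕ) [Fact p.Prime], W.HasGoodReductionAtPrime p →
      ∀ w : HeightOneSpectrum (𝓞 K₁), (p : 𝓞 K₁) ∈ w.asIdeal →
        ψ.IsUnramifiedAt w ∧
        (c • w ≠ w →
          ψ.valueAtUniformizer w + ψ.valueAtUniformizer (c • w) = (W.frobeniusTrace p : ℂ) ∧
          ψ.valueAtUniformizer w * ψ.valueAtUniformizer (c • w) = (p : ℂ)) ∧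
        (c • w = w → W.frobeniusTrace p = 0 ∧ ψ.valueAtUniformizer w = -(p : ℂ)) := by
  intro p _ hp w hw
  have hp₁ : W₁.HasGoodReductionAtPrime p := (hiso.hasGoodReductionAtPrime_iff p).mp hp
  have htr : W.frobeniusTrace p = W₁.frobeniusTrace p := frobeniusTrace_eq_of_isIsogenous hiso p hp hp₁
  rw [htr]
  exact h p hp₁ w hw

/-- **Clause (v) transported**: `L(s, ψ) = L(W₁, s)` on `re s > 3/2` and `L(W, s) = L(W₁, s)` for isogenous curves (Faltings §5 Kor. 2;
Knapp Thm. 11.67). [cite: Faltings1983Endlichkeit, §5 Korollar 2] [cite: Knapp1993, Thm. 11.67 (PDF p. 281)] -/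
theorem deuring_v_of_isIsogenous {W W₁ : WeierstrassCurve ℚ} [W.IsElliptic] [W₁.IsElliptic] (hiso : IsIsogenous W W₁)
    {ψ : HeckeCharacter K₁} (h : ∀ s : ℂ, 3 / 2 < s.re → heckeLFunction ψ s = W₁.LSeries s) :
    ∀ s : ℂ, 3 / 2 < s.re → heckeLFunction ψ s = W.LSeries s := by
  intro s hs
  rw [h s hs, hiso.LSeries_eq]

/-- **The newform transports**: `IsNewformOf W f → IsNewformOf W₁ f` for `ℚ`-isogenous `W ∼ W₁` (same `aₙ`; Knapp Thm. 11.67).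
[cite: Knapp1993, Thm. 11.67 (PDF p. 281)] -/
theorem isNewformOf_of_isIsogenous {W W₁ : WeierstrassCurve ℚ} [W.IsElliptic] [W₁.IsElliptic] (hiso : IsIsogenous W W₁)
    {N : ℕ} [NeZero N] {f : CuspForm (Gamma0 N) 2} (hf : IsNewformOf W f) : IsNewformOf W₁ f :=
  hf.of_isIsogenous hiso.symm_of_charZero

/-! ## §3 Deuring's character for every CM curve over `ℚ` -/

/-- **DEURING'S GRÖSSENCHARACTER FOR ALL THIRTEEN CM `j` (granted the named fact at maximal `j`).** Let
`hD : Deuring_exists_heckeCharacter_of_maximalCM`. For every CM elliptic curve `W/ℚ` (globally minimal model, `W.HasCM` — ANY order), every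
quadratic number field `K₁` with `θ² = cmFieldDiscrOfJ W.j` (the CM FIELD of `W`; e.g. `ℚ⟮x⟯ ⊆ L` at the frame) and its non-trivial
automorphism `c`, there are: a globally minimal `W₁`, `ℚ`-isogenous to `W`, with `W₁.j ∈ maximalCMJInvariants`, `W₁.HasCM`,
`IsCMFieldOfJ K₁ W₁.j`; and a Hecke character `ψ` of `K₁` with Deuring's clauses FOR `W` ITSELF: (i) type `(1,0)`; (ii) `c`-equivariance;
(iii) `ψ` unramified at `w ↔ W ⊗ K₁` good at `w` (stated for `W` and for `W₁`); (iv) at good `ℓ`: `ψ(𝔮) + ψ(c𝔮) = a_ℓ(W)`, `ψ(𝔮)ψ(c𝔮) = ℓ`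
(split), `a_ℓ(W) = 0 ∧ ψ(𝔮) = −ℓ` (inert); (v) `L(s, ψ) = L(W, s)` on `re s > 3/2`. Silverman II Thm. 10.5 + *AEC* VII.7.2 + Faltings.
[cite: SilvermanATAEC1994, Ch. II Thm. 9.2 and Thm. 10.5 (pp. 165–175)] [cite: SilvermanAEC2009, Cor. VII.7.2] -/
theorem exists_deuringCharacter_of_hasCM (hD : Deuring_exists_heckeCharacter_of_maximalCM) (W : WeierstrassCurve ℚ)
    [W.IsElliptic] [W.IsGloballyMinimal] (hCM : W.HasCM) (h2 : Module.finrank ℚ K₁ = 2)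
    (hθ : ∃ θ : K₁, θ ^ 2 = (cmFieldDiscrOfJ W.j : K₁)) (c : K₁ ≃ₐ[ℚ] K₁) (hc : c ≠ 1) :
    ∃ (W₁ : WeierstrassCurve ℚ) (_ : W₁.IsElliptic) (_ : W₁.IsGloballyMinimal),
      IsIsogenous W W₁ ∧ W₁.j ∈ maximalCMJInvariants ∧ W₁.HasCM ∧ IsCMFieldOfJ K₁ W₁.j ∧
      ∃ ψ : HeckeCharacter K₁,
        ψ.HasInfinityType (fun _ ↦ 1) (fun _ ↦ 0) ∧
        IsHeckeConjEquivariant c ψ ∧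
        (∀ w : HeightOneSpectrum (𝓞 K₁), ψ.IsUnramifiedAt w ↔ (W.baseChange K₁).HasGoodReductionAt w) ∧
        (∀ w : HeightOneSpectrum (𝓞 K₁), ψ.IsUnramifiedAt w ↔ (W₁.baseChange K₁).HasGoodReductionAt w) ∧
        (∀ (p : ℕ) [Fact p.Prime], W.HasGoodReductionAtPrime p →
          ∀ w : HeightOneSpectrum (𝓞 K₁), (p : 𝓞 K₁) ∈ w.asIdeal →
            ψ.IsUnramifiedAt w ∧
            (c • w ≠ w →
              ψ.valueAtUniformizer w + ψ.valueAtUniformizer (c • w) = (W.frobeniusTrace p : ℂ) ∧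
              ψ.valueAtUniformizer w * ψ.valueAtUniformizer (c • w) = (p : ℂ)) ∧
            (c • w = w → W.frobeniusTrace p = 0 ∧ ψ.valueAtUniformizer w = -(p : ℂ))) ∧
        (∀ s : ℂ, 3 / 2 < s.re → heckeLFunction ψ s = W.LSeries s) := by
  obtain ⟨W₁, hE₁, hmin₁, hiso, hj₁, hCM₁, -, hK₁⟩ := exists_maximal_model W hCM h2 hθ
  haveI := hE₁
  haveI := hmin₁
  obtain ⟨ψ, h1, h2c, h3, h4, h5⟩ := hD W₁ hj₁ K₁ hK₁ c hc
  exact ⟨W₁, hE₁, hmin₁, hiso, hj₁, hCM₁, hK₁, ψ, h1, h2c, deuring_iii_of_isIsogenous hiso h3, h3,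
    deuring_iv_of_isIsogenous hiso h4, deuring_v_of_isIsogenous hiso h5⟩

/-! ## §4 The `K_CM`-element datum of `…CMFieldTheta` for every CM curve -/

/-- **The `K_CM`-element datum (`…CMFieldTheta.exists_theta_datum`) for ALL thirteen CM `j`.** For `W/ℚ` CM (any order, globally minimal
model), `K₁` quadratic with `θ² = cmFieldDiscrOfJ W.j` and `c ≠ 1`: `∃ θ₀ a` with `c • θ₀ = a − θ₀`, `a − 2θ₀` in no prime of norm `ℓ²`, and
every `ℓ` below a prime containing `a − 2θ₀` BAD for `W` (run the nine-field datum on the maximal model `W₁` and transport badness back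
along the isogeny, *AEC* VII.7.2). [cite: SilvermanATAEC1994, App. A §3] [cite: SilvermanAEC2009, Cor. VII.7.2] -/
theorem exists_theta_datum_of_hasCM (W : WeierstrassCurve ℚ) [W.IsElliptic] (hCM : W.HasCM) (h2 : Module.finrank ℚ K₁ = 2)
    (hθ : ∃ θ : K₁, θ ^ 2 = (cmFieldDiscrOfJ W.j : K₁)) {c : K₁ ≃ₐ[ℚ] K₁} (hc : c ≠ 1) :
    ∃ (θ₀ : 𝓞 K₁) (a : ℤ), c • θ₀ = (a : 𝓞 K₁) - θ₀ ∧
      (∀ 𝔮 : HeightOneSpectrum (𝓞 K₁), Ideal.absNorm 𝔮.asIdeal = (Ideal.absNorm 𝔮.asIdeal).minFac ^ 2 →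
        (a : 𝓞 K₁) - 2 * θ₀ ∉ 𝔮.asIdeal) ∧
      (∀ (ℓ : ℕ) [Fact ℓ.Prime] (𝔮 : HeightOneSpectrum (𝓞 K₁)), (ℓ : 𝓞 K₁) ∈ 𝔮.asIdeal →
        (a : 𝓞 K₁) - 2 * θ₀ ∈ 𝔮.asIdeal → ¬ W.HasGoodReductionAtPrime ℓ) := by
  obtain ⟨W₁, hE₁, hmin₁, hiso, hj₁, hCM₁, -, hK₁⟩ := exists_maximal_model W hCM h2 hθ
  haveI := hE₁
  haveI := hmin₁
  obtain ⟨θ₀, a, hcθ, hθ', hθram⟩ :=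
    BiquadraticEisensteinDescentEisensteinHeartFlatCMInertBadKPrimeCMFieldTheta.exists_theta_datum W₁ hCM₁ hj₁ hK₁ hc
  refine ⟨θ₀, a, hcθ, hθ', fun ℓ _ 𝔮 hℓ hmem hgood ↦ ?_⟩
  exact hθram ℓ 𝔮 hℓ hmem ((hiso.hasGoodReductionAtPrime_iff ℓ).mp hgood)

/-- **HYPOTHESIS (L) OF THE KATZ–HSIEH SOCKET, ONE CALL, for every CM curve, granted Deuring's named fact's OUTPUT for `W`.** This is
`…CMFieldTheta.hLval_of_deuring_of_cmField_of_isCMFieldOfJ` with `W.j ∈ maximalCMJInvariants` / `IsCMFieldOfJ` replaced by `W.HasCM` and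
`θ² = cmFieldDiscrOfJ W.j` in `K₁` (any of the thirteen `j`); `ψ` is any Hecke character of `K₁` with Deuring's clauses (i),(iv) FOR `W` (as
delivered by `exists_deuringCharacter_of_hasCM`) and `hψbad`. [cite: SilvermanATAEC1994, Ch. II Thm. 10.5 (b), App. A §3] [cite: Hsieh2014mu, Prop. 4.9 (§4.8)] -/
theorem hLval_of_deuring_of_hasCM {K L : Type} [Field K] [NumberField K] [Field L] [NumberField L]
    [Algebra K₁ L] [IsGalois K₁ L] [Algebra K L] [IsGalois K L]
    [IsTotallyComplex L] [IsCMField L] [IsTotallyComplex K] [IsTotallyComplex K₁] [IsGalois ℚ K₁]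
    {p : ℕ} [Fact p.Prime] {ι : PadicAlgCl p ≃+* ℂ} {Sp : Finset (HeightOneSpectrum (𝓞 L))} (hSp : KatzCM.IsPAdicCMType p Sp)
    (W : WeierstrassCurve ℚ) [W.IsElliptic] [W.IsGloballyMinimal] [NeZero (W.conductorNorm ℤ)] (hCM : W.HasCM)
    (h2K₁ : Module.finrank ℚ K₁ = 2) (hθ : ∃ θ : K₁, θ ^ 2 = (cmFieldDiscrOfJ W.j : K₁))
    {c : K₁ ≃ₐ[ℚ] K₁} (hc : c ≠ 1) {ψ : HeckeCharacter K₁} (hψ1 : ψ.HasInfinityType (fun _ ↦ 1) (fun _ ↦ 0))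
    (hψgood : ∀ (ℓ : ℕ) [Fact ℓ.Prime], W.HasGoodReductionAtPrime ℓ →
      ∀ 𝔮 : HeightOneSpectrum (𝓞 K₁), (ℓ : 𝓞 K₁) ∈ 𝔮.asIdeal →
        ψ.IsUnramifiedAt 𝔮 ∧
        (c • 𝔮 ≠ 𝔮 →
          ψ.valueAtUniformizer 𝔮 + ψ.valueAtUniformizer (c • 𝔮) = (W.frobeniusTrace ℓ : ℂ) ∧
          ψ.valueAtUniformizer 𝔮 * ψ.valueAtUniformizer (c • 𝔮) = (ℓ : ℂ)) ∧
        (c • 𝔮 = 𝔮 → W.frobeniusTrace ℓ = 0 ∧ ψ.valueAtUniformizer 𝔮 = -(ℓ : ℂ)))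
    (hψbad : ∀ (ℓ : ℕ) [Fact ℓ.Prime], ¬ W.HasGoodReductionAtPrime ℓ →
      ∀ w : HeightOneSpectrum (𝓞 L), (ℓ : 𝓞 L) ∈ w.asIdeal → ¬ (ψ.compRelNorm L).IsUnramifiedAt w)
    {f : CuspForm (Gamma0 (W.conductorNorm ℤ)) 2} (hf : IsNewformOf W f)
    (h2K : Module.finrank ℚ K = 2) (h2L : Module.finrank K L = 2)
    (h2L₁ : Module.finrank K₁ L = 2) {τ : L ≃ₐ[K] L} (hτ : τ ≠ 1) (hτc : (τ.restrictScalars ℚ).restrictNormal K₁ = c)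
    {ν : HeckeCharacter L} (hν : ∀ x : ideleGroup L, ((ν x : ℂˣ) : ℂ) = ((ideleNorm x : ℝ) : ℂ) ^ (1 : ℂ))
    {κ_ : ℕ → InfinitePlace L → ℕ}
    (hT : ∀ (χ : HeckeCharacter K) (n : ℕ), 0 < n → (∀ v : HeightOneSpectrum (𝓞 K), χ.IsUnramifiedAt v) →
      χ.HasInfinityType (fun _ ↦ (n : ℤ)) (fun _ ↦ -(n : ℤ)) →
      KatzCM.HasKatzType ι Sp (ψ.compRelNorm L * ν * χ.compRelNorm L) 1 (κ_ n)) :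
    ∀ (χ : HeckeCharacter K) (n : ℕ), 0 < n → (∀ v : HeightOneSpectrum (𝓞 K), χ.IsUnramifiedAt v) →
      χ.HasInfinityType (fun _ ↦ (n : ℤ)) (fun _ ↦ -(n : ℤ)) →
      ∀ hL : LFunction.HasEntireContinuation (heckeLFunction (ψ.compRelNorm L * ν * χ.compRelNorm L)),
        hL.continuation 0 = 1 * 1 ^ n * rankinSelbergValueHecke f χ 1 := by
  obtain ⟨θ₀, a, hcθ, hθ', hθram⟩ := exists_theta_datum_of_hasCM W hCM h2K₁ hθ hc
  exact BiquadraticEisensteinDescentEisensteinHeartFlatCMInertBadKPrimeKatzHsiehLValueCM.hLval_of_deuring_of_cmField hSp W hCM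
    c hψ1 hψgood hψbad hf h2K₁ h2K h2L h2L₁ hτ hτc θ₀ a hcθ hθ' hθram hν hT

end Summit.BirchSwinnertonDyer.BirchSwinnertonDyer.Theorems.BiquadraticEisensteinDescentEisensteinHeartFlatCMInertBadKPrimeDeuringTransport

end
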